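import Literature.MathematicalPhysics.QuantumFieldTheory.BalabanImbrieJaffe1984to88.BIJ88Eq5145CornerUrsell

/-!
# `BalabanImbrieJaffe1984to88.BIJ88Eq5145Remainder` — T. Bałaban, J. Imbrie, A. Jaffe, *Effective action and cluster properties of the abelian
Higgs model*, Commun. Math. Phys. **114** (1988) 257–315 [BalabanImbrieJaffe1988]: Sect. 5.14, p. 312 [PDF 56], **(5.14.5) ON THE §5.13
GAUSSIAN MODEL WITH THE REMAINDER `ℛ_k(Λ₁₂)` OF (5.14.2) IN THE EXPONENT BY NAME** (rows `C2.Eq5.14.5`, `C2.Eq5.14.1-5.14.2`; corollaries of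
`BIJ88Eq5145CornerUrsell.eq5145_zG_linear_Tsum_of_ineq5144`). Print writes the exponent of (5.14.5) as `−𝒫^L_{k+1,loc} − Σ_X W₆^{(k)}(X)` with
`W₆ = W₆′ + W₆″` (p. 311) and `ℛ_k(Λ₁₂^{(k)}) = Σ_{X⊂Λ₁₂^{(k)}} W₆^{(k)′}(X)` (p. 310, display 4 — the DEFINITION of the `W₆′(X)` as the
support-`X` parts of the connected-graph expansion of `ℛ_k`). Reading display 4 right to left, the exponent is `−𝒫^L − Σ_X W₆″(X) − ℛ_k(Λ₁₂)`,
and `ℛ_k(Λ₁₂) = (n̄+1)·remR(t ↦ Σ_γ T_{γ,t})` IS BY NAME on the model (p36 g12's `effectiveAction_fieldLaw_eq_pertP_add_remR_Tsum_of_ineq5144`,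
modulo the leaf (5.14.4)); so here (5.14.5) is stated with `ℛ_k` itself in the exponent — NO `W₆′` data and no regrouping hypothesis `hrem`.

HONEST FRAMING (cell `lit-balaban`, verbatim): statement-level skeleton of published theorems with citation tags; proofs where landed; nothing here is a claim about the Yang–Mills mass gap.

PDF held: `paper:balaban1988-cmp114-bij-abelian-higgs-effective-action` (journal page = PDF page + 256); pp. 308–312 = PDF 52–56, read this
session. p. 310 [PDF 54], verbatim: *"ℛ_k(Λ₁₂^{(k)}) = Σ_{X⊂Λ₁₂^{(k)}} W₆^{(k)′}(X). W₆^{(k)′}(X) is obtained by summing only over {X_γ}, (Y₁, …,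
Y_B) which fill X"*; p. 311: *"W₆^{(k)}(X) = W₆^{(k)′}(X) + W₆^{(k)″}(X)"*; (5.14.5) p. 312 quoted in `BIJ88Eq5145CornerModel`.

**What is proved (0 `sorry`, standard axioms, 0 defs, 0 new `Prop` facts).** **`eq5145_zG_linear_remR_of_ineq5144`** — for the linear slot
fields of the print on the §5.13 Gaussian model with the p. 308 cube factors: `e^{−V_const}·⟨Π_{i∈W} u_i F_i⟩_{1,W} = Σ_{ρ admissible outer}
(Π_{X∈ρ} g₁ X)·(z_F/z)(Λ₁₂)(Λ₁₂′)·exp(−𝒫^L − Σ_X W₆″(X) − ℛ_k(Λ₁₂))` with `ℛ_k(Λ₁₂) := (n̄+1)·remR(t ↦ Σ_γ T_{γ,t}(L))` the connected-graph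
remainder of (5.14.2) for the located slot data of `Λ₁₂` and the form `Δ_{1_{Λ₁₂′}}` — (5.13.4), (5.14.1), (5.14.2) through `t = 0`, display 3,
*"z_F = (z_F/z)·z"*, `z > 0`, the Gaussianity of the slot fields ALL BY NAME / PROVED; displayed per region: a slot in the region (`s₀`), the
mean-field centring `hcen`, THE LEAF (5.14.4) (`h5144`, r16's typed `Ineq5144`, gen 5's regime) and p. 311 (`h311 : V_const + 𝒫̃ = 𝒫^L +
Σ_X W₆″(X)`); **`eq5145_zG_linear_noSource_remR_of_ineq5144`** — `ℱ = 0`: `hcen` automatic, displayed per region ONLY `s₀`, the leaf and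
p. 311. HONEST SCOPE: as in `BIJ88Eq5145CornerModel`/`BIJ88Eq5145CornerUrsell` (cube-local observables; the IBP structure of `z_F/z` — p. 312,
Claim@312's files — not re-derived on the model; (5.14.1)'s located inner factor `z(Λ₁₂)(Λ₁₂′)` verbatim; the `(n̄+1)!` slip G-C2-p36-06); the
`W₆′(X)`-level locality/decay of display 4 (needed for the BOUNDS of §5.15, not for the identity (5.14.5)) is p25's `BIJ88W6PrimeBound`/
`BIJ88RemainderW6Tsum` in the `polys`/`loc ∘ γ` currency and is not restated in the virtual-support currency here. Imports
`BIJ88Eq5145CornerUrsell` only; modifies nothing. NOT summit progress; NOT continuum; NOT Clay. Cell `lit-balaban` Phase 2, seat p25 gen 13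
(row owner r16, referee ref-5).
-/

noncomputable section

open Finset MeasureTheory ProbabilityTheory
open Literature.MathematicalPhysics.QuantumFieldTheory.BalabanImbrieJaffe1984to88.BIJ88DirichletForms305 (interpForm)
open Literature.MathematicalPhysics.QuantumFieldTheory.BalabanImbrieJaffe1984to88.BIJ88PolymerRep5134 (g1 IsAdmissible corner)
open Literature.MathematicalPhysics.QuantumFieldTheory.BalabanImbrieJaffe1984to88.BIJ88PolymerRep5134Gauss (ext obs prec src expect zG)
open Literature.MathematicalPhysics.QuantumFieldTheory.BalabanImbrieJaffe1984to88.BIJ88Resummation5141 (outer lam12 lam12_subset)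
open Literature.MathematicalPhysics.QuantumFieldTheory.BalabanImbrieJaffe1984to88.BIJ88Resummation5141Adm (lam12')
open Literature.MathematicalPhysics.QuantumFieldTheory.BalabanImbrieJaffe1984to88.BIJ88Expansion5143 (g3 prime)
open Literature.MathematicalPhysics.QuantumFieldTheory.BalabanImbrieJaffe1984to88.BIJ88Expansion5143Gauss (fD)
open Literature.MathematicalPhysics.QuantumFieldTheory.BalabanImbrieJaffe1984to88.BIJ88Expansion5143Ordered (polysOf cvsupp locv wv)
open Literature.MathematicalPhysics.QuantumFieldTheory.BalabanImbrieJaffe1984to88.BIJ88ConnectedGraphResummation (Tsum)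
open Literature.MathematicalPhysics.QuantumFieldTheory.BalabanImbrieJaffe1984to88.BIJ88SlotMomentsGauss308 (uD ext_zero)
open Literature.MathematicalPhysics.QuantumFieldTheory.BalabanImbrieJaffe1984to88.BIJ88Ineq5113Covering (cubeSys)
open Literature.MathematicalPhysics.QuantumFieldTheory.BalabanImbrieJaffe1984to88.BIJ88Sect5Statements (CutoffProfile)
open Literature.MathematicalPhysics.QuantumFieldTheory.BalabanImbrieJaffe1984to88.BIJ88Sect5StatementsPart2 (Ineq5144)
open Literature.MathematicalPhysics.QuantumFieldTheory.BalabanImbrieJaffe1984to88.BIJ88Sect5StatementsPart4 (remR pertP)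
open Literature.MathematicalPhysics.QuantumFieldTheory.BalabanImbrieJaffe1984to88.BIJ88Eq5145CornerModel
open Literature.MathematicalPhysics.QuantumFieldTheory.BalabanImbrieJaffe1984to88.BIJ88Eq5145CornerUrsell

namespace Literature.MathematicalPhysics.QuantumFieldTheory.BalabanImbrieJaffe1984to88.BIJ88Eq5145Remainder

variable {α I : Type} [Fintype α] [DecidableEq α] [Fintype I] [DecidableEq I]
  (blk : α → I) (Δ : Matrix α α ℝ) (ℱ : α → ℝ)
variable (adj : I → I → Prop) [DecidableRel adj]
variable (χ : CutoffProfile) {ι υ : Type*} [DecidableEq ι] [DecidableEq υ]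
variable {p ek : ℝ} {B : Finset ι} {Φ : ι → (α → ℝ) → ℝ} {c : ι → ℝ} {Ys : Finset υ} {V : υ → (α → ℝ) → ℝ}
variable (cube : ↥B ⊕ ↥Ys → I) {L : Type*} (γ : L → ↥B ⊕ ↥Ys)

omit [Fintype α] [DecidableEq α] [Fintype I] [DecidableEq I] [DecidableRel adj] [DecidableEq ι] [DecidableEq υ] in
/-- bookkeeping: a sum over `𝒳 ∋ X₀` of `W₆″ +` (the remainder placed at `X₀`) is `Σ W₆″ + ℛ`. [cite: BalabanImbrieJaffe1988, p.310 display 4] -/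
theorem sum_add_ite_eq {Xt : Type*} [DecidableEq Xt] (𝒳 : Finset Xt) {X₀ : Xt} (hX₀ : X₀ ∈ 𝒳) (g : Xt → ℝ) (r : ℝ) :
    ∑ X ∈ 𝒳, ((if X = X₀ then r else 0) + g X) = r + ∑ X ∈ 𝒳, g X := by
  rw [sum_add_distrib, sum_ite_eq' 𝒳 X₀ (fun _ => r), if_pos hX₀]

/-- **(5.14.5) ON THE MODEL, LINEAR SLOT FIELDS, WITH `ℛ_k(Λ₁₂)` IN THE EXPONENT BY NAME** (display 4 read as the definition of `Σ_X W₆′(X)`):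
`e^{−V_const}·⟨Π u_i F_i⟩_{1,W} = Σ_ρ (Π g₁)·(z_F/z)(Λ₁₂)(Λ₁₂′)·exp(−𝒫^L − Σ_{X∈𝒳} W₆″(X) − (n̄+1)·remR(t ↦ Σ_γ T_{γ,t}(L)))`, the remainder being
p36 g12's connected-graph remainder of (5.14.2) for the located slot data of `Λ₁₂` and `Δ_{1_{Λ₁₂′}}` (modulo the leaf (5.14.4)). Displayed per
region: `s₀`, `hcen`, `h5144`, `h311`; `𝒳` any index set with a member `X₀` (print: the regions `X`).
[cite: BalabanImbrieJaffe1988, (5.14.5) p.312; (5.14.2) p.308; p.310 displays 3–4; (5.14.4) p.309] -/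
theorem eq5145_zG_linear_remR_of_ineq5144 {nbr : I → Finset I} {D : ℕ} {θ β' : ℝ} (hR : ∀ x y, adj x y → adj y x)
    (hD : ∀ x, (nbr x).card ≤ D) (hnbr : ∀ x y, adj x y → y ∈ nbr x) (hθ0 : 0 < θ) (hθ1 : θ ≤ 1) (hβ : 0 ≤ β')
    (hsmall : 16 * ((D : ℝ) + 1) ^ 2 * (θ ^ (β' / 2) * Real.exp 2) ≤ 1)
    (hΔadj : ∀ x y, blk x ≠ blk y → ¬ adj (blk x) (blk y) → Δ x y = 0) (hΔ : Δ.PosDef)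
    (hχ : ∀ x, 0 ≤ χ.χ₁ x) (hp : 1 / 2 < p) (hlin : ∀ b ∈ B, IsLinearMap ℝ (Φ b)) {c₀ : ℝ} (hc₀ : 0 < c₀)
    (hcb : ∀ b ∈ B, c₀ ≤ c b) (hV : ∀ Y ∈ Ys, Measurable (V Y)) {KY : υ → ℝ} (hK : ∀ Y ∈ Ys, ∀ φ, |V Y φ| ≤ KY Y)
    (hek : 0 < ek) (hek1 : ek < Real.exp (-1))
    (hΦloc : ∀ b : B, ∀ φ ψ : α → ℝ, (∀ x, blk x = cube (Sum.inl b) → φ x = ψ x) → Φ b φ = Φ b ψ)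
    (hVloc : ∀ Y : Ys, ∀ φ ψ : α → ℝ, (∀ x, blk x = cube (Sum.inr Y) → φ x = ψ x) → V Y φ = V Y ψ)
    (F : I → (α → ℝ) → ℝ) (hFloc : ∀ i (φ ψ : α → ℝ), (∀ x, blk x = i → φ x = ψ x) → F i φ = F i ψ)
    {L' : Type} [Fintype L'] [DecidableEq L'] {nbar : ℕ} (hL : Fintype.card L' = nbar + 1)
    (W Bl : Finset I) {Xt : Type*} [DecidableEq Xt] (𝒳 : Finset Xt) {X₀ : Xt} (hX₀ : X₀ ∈ 𝒳) (Vconst PL : ℝ)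
    (W6pp : Finset (Finset I) → Xt → ℝ)
    (s₀ : (ρ : Finset (Finset I)) → ↥(slotB B Ys cube (lam12 W ρ)) ⊕ ↥(slotY B Ys cube (lam12 W ρ)))
    (hcen : ∀ ρ ∈ (outer W Bl).filter (IsAdmissible adj), ∀ b ∈ slotB B Ys cube (lam12 W ρ),
      Φ b (ext blk (lam12 W ρ) ((prec blk Δ (lam12 W ρ) (corner ℝ (lam12' adj W ρ)))⁻¹.mulVec (src blk ℱ (lam12 W ρ)))) = 0)
    (h5144 : ∀ ρ ∈ (outer W Bl).filter (IsAdmissible adj), ∀ t ∈ Set.Ioc (0 : ℝ) 1,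
      ∀ γ' : L' → ↥(slotB B Ys cube (lam12 W ρ)) ⊕ ↥(slotY B Ys cube (lam12 W ρ)),
      Ineq5144 (cubeSys I) (Finset L')
        (prime (g3 adj fun H' => zG blk (interpForm blk Δ (corner ℝ (lam12' adj W ρ))) ℱ
          (fD (uD χ p ek (slotB B Ys cube (lam12 W ρ)) (fun b : ↥B => Φ b) (fun b : ↥B => c b) (slotY B Ys cube (lam12 W ρ))
            (fun Y : ↥Ys => V Y) t) (cubeIn cube (lam12 W ρ)) γ' H')))
        Finset.card (fun H (X' : Finset I) => (X' \ H.image (cubeIn cube (lam12 W ρ) ∘ γ')).card) θ β')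
    (h311 : ∀ ρ ∈ (outer W Bl).filter (IsAdmissible adj),
      Vconst + pertP (fun t => Real.log (ztIn blk Δ ℱ χ p ek B Φ c Ys V cube (lam12 W ρ) (lam12' adj W ρ) t)) nbar =
        PL + ∑ X' ∈ 𝒳, W6pp ρ X') :
    Real.exp (-Vconst) * expect blk Δ ℱ (fun i φ => fD (uD χ p ek B Φ c Ys V 1) cube γ ∅ i φ * F i φ) W (corner ℝ W) =
      ∑ ρ ∈ (outer W Bl).filter (IsAdmissible adj),
        (∏ X ∈ ρ, g1 adj (zG blk Δ ℱ (fun i φ => fD (uD χ p ek B Φ c Ys V 1) cube γ ∅ i φ * F i φ)) X) *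
          (zG blk Δ ℱ (fun i φ => fD (uD χ p ek B Φ c Ys V 1) cube γ ∅ i φ * F i φ) (lam12 W ρ) (lam12' adj W ρ) /
              zG blk Δ ℱ (fD (uD χ p ek B Φ c Ys V 1) cube γ ∅) (lam12 W ρ) (lam12' adj W ρ) *
            Real.exp (-PL - ∑ X' ∈ 𝒳, W6pp ρ X' -
              (nbar + 1 : ℝ) * remR (fun t => ∑ γ' : L' → ↥(slotB B Ys cube (lam12 W ρ)) ⊕ ↥(slotY B Ys cube (lam12 W ρ)),
                Tsum ((polysOf (lam12 W ρ)).image (cvsupp adj (lam12 W ρ))) (locv (cubeIn cube (lam12 W ρ) ∘ γ'))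
                  (wv (prime (g3 adj fun H' => zG blk (interpForm blk Δ (corner ℝ (lam12' adj W ρ))) ℱ
                    (fD (uD χ p ek (slotB B Ys cube (lam12 W ρ)) (fun b : ↥B => Φ b) (fun b : ↥B => c b)
                      (slotY B Ys cube (lam12 W ρ)) (fun Y : ↥Ys => V Y) t) (cubeIn cube (lam12 W ρ)) γ' H')))) univ) nbar)) := by
  have h := eq5145_zG_linear_Tsum_of_ineq5144 blk Δ ℱ adj χ cube γ hR hD hnbr hθ0 hθ1 hβ hsmall hΔadj hΔ hχ hp hlin hc₀ hcb hV hK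
    hek hek1 hΦloc hVloc F hFloc hL W Bl 𝒳 Vconst PL
    (fun ρ X' => if X' = X₀ then (nbar + 1 : ℝ) * remR (fun t => ∑ γ' : L' → ↥(slotB B Ys cube (lam12 W ρ)) ⊕ ↥(slotY B Ys cube (lam12 W ρ)),
        Tsum ((polysOf (lam12 W ρ)).image (cvsupp adj (lam12 W ρ))) (locv (cubeIn cube (lam12 W ρ) ∘ γ'))
          (wv (prime (g3 adj fun H' => zG blk (interpForm blk Δ (corner ℝ (lam12' adj W ρ))) ℱ
            (fD (uD χ p ek (slotB B Ys cube (lam12 W ρ)) (fun b : ↥B => Φ b) (fun b : ↥B => c b)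
              (slotY B Ys cube (lam12 W ρ)) (fun Y : ↥Ys => V Y) t) (cubeIn cube (lam12 W ρ)) γ' H')))) univ) nbar else 0)
    W6pp s₀ hcen h5144 (fun ρ _ => by rw [sum_ite_eq' 𝒳 X₀, if_pos hX₀]) h311
  simp only [sum_add_ite_eq 𝒳 hX₀] at h
  rw [h]
  refine sum_congr rfl fun ρ _ => ?_
  congr 2
  ring_nf

/-- **… WITHOUT A LINEAR SOURCE (`ℱ = 0`)**: `hcen` automatic; displayed per region ONLY a slot in the region (`s₀`), the leaf (5.14.4) (`h5144`)
and p. 311 (`h311`). [cite: BalabanImbrieJaffe1988, (5.14.5) p.312; (5.14.2) p.308; p.310 displays 3–4; (5.14.4) p.309] -/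
theorem eq5145_zG_linear_noSource_remR_of_ineq5144 {nbr : I → Finset I} {D : ℕ} {θ β' : ℝ} (hR : ∀ x y, adj x y → adj y x)
    (hD : ∀ x, (nbr x).card ≤ D) (hnbr : ∀ x y, adj x y → y ∈ nbr x) (hθ0 : 0 < θ) (hθ1 : θ ≤ 1) (hβ : 0 ≤ β')
    (hsmall : 16 * ((D : ℝ) + 1) ^ 2 * (θ ^ (β' / 2) * Real.exp 2) ≤ 1)
    (hΔadj : ∀ x y, blk x ≠ blk y → ¬ adj (blk x) (blk y) → Δ x y = 0) (hΔ : Δ.PosDef)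
    (hχ : ∀ x, 0 ≤ χ.χ₁ x) (hp : 1 / 2 < p) (hlin : ∀ b ∈ B, IsLinearMap ℝ (Φ b)) {c₀ : ℝ} (hc₀ : 0 < c₀)
    (hcb : ∀ b ∈ B, c₀ ≤ c b) (hV : ∀ Y ∈ Ys, Measurable (V Y)) {KY : υ → ℝ} (hK : ∀ Y ∈ Ys, ∀ φ, |V Y φ| ≤ KY Y)
    (hek : 0 < ek) (hek1 : ek < Real.exp (-1))
    (hΦloc : ∀ b : B, ∀ φ ψ : α → ℝ, (∀ x, blk x = cube (Sum.inl b) → φ x = ψ x) → Φ b φ = Φ b ψ)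
    (hVloc : ∀ Y : Ys, ∀ φ ψ : α → ℝ, (∀ x, blk x = cube (Sum.inr Y) → φ x = ψ x) → V Y φ = V Y ψ)
    (F : I → (α → ℝ) → ℝ) (hFloc : ∀ i (φ ψ : α → ℝ), (∀ x, blk x = i → φ x = ψ x) → F i φ = F i ψ)
    {L' : Type} [Fintype L'] [DecidableEq L'] {nbar : ℕ} (hL : Fintype.card L' = nbar + 1)
    (W Bl : Finset I) {Xt : Type*} [DecidableEq Xt] (𝒳 : Finset Xt) {X₀ : Xt} (hX₀ : X₀ ∈ 𝒳) (Vconst PL : ℝ)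
    (W6pp : Finset (Finset I) → Xt → ℝ)
    (s₀ : (ρ : Finset (Finset I)) → ↥(slotB B Ys cube (lam12 W ρ)) ⊕ ↥(slotY B Ys cube (lam12 W ρ)))
    (h5144 : ∀ ρ ∈ (outer W Bl).filter (IsAdmissible adj), ∀ t ∈ Set.Ioc (0 : ℝ) 1,
      ∀ γ' : L' → ↥(slotB B Ys cube (lam12 W ρ)) ⊕ ↥(slotY B Ys cube (lam12 W ρ)),
      Ineq5144 (cubeSys I) (Finset L')
        (prime (g3 adj fun H' => zG blk (interpForm blk Δ (corner ℝ (lam12' adj W ρ))) (0 : α → ℝ)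
          (fD (uD χ p ek (slotB B Ys cube (lam12 W ρ)) (fun b : ↥B => Φ b) (fun b : ↥B => c b) (slotY B Ys cube (lam12 W ρ))
            (fun Y : ↥Ys => V Y) t) (cubeIn cube (lam12 W ρ)) γ' H')))
        Finset.card (fun H (X' : Finset I) => (X' \ H.image (cubeIn cube (lam12 W ρ) ∘ γ')).card) θ β')
    (h311 : ∀ ρ ∈ (outer W Bl).filter (IsAdmissible adj),
      Vconst + pertP (fun t => Real.log (ztIn blk Δ (0 : α → ℝ) χ p ek B Φ c Ys V cube (lam12 W ρ) (lam12' adj W ρ) t)) nbar =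
        PL + ∑ X' ∈ 𝒳, W6pp ρ X') :
    Real.exp (-Vconst) * expect blk Δ (0 : α → ℝ) (fun i φ => fD (uD χ p ek B Φ c Ys V 1) cube γ ∅ i φ * F i φ) W (corner ℝ W) =
      ∑ ρ ∈ (outer W Bl).filter (IsAdmissible adj),
        (∏ X ∈ ρ, g1 adj (zG blk Δ (0 : α → ℝ) (fun i φ => fD (uD χ p ek B Φ c Ys V 1) cube γ ∅ i φ * F i φ)) X) *
          (zG blk Δ (0 : α → ℝ) (fun i φ => fD (uD χ p ek B Φ c Ys V 1) cube γ ∅ i φ * F i φ) (lam12 W ρ) (lam12' adj W ρ) /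
              zG blk Δ (0 : α → ℝ) (fD (uD χ p ek B Φ c Ys V 1) cube γ ∅) (lam12 W ρ) (lam12' adj W ρ) *
            Real.exp (-PL - ∑ X' ∈ 𝒳, W6pp ρ X' -
              (nbar + 1 : ℝ) * remR (fun t => ∑ γ' : L' → ↥(slotB B Ys cube (lam12 W ρ)) ⊕ ↥(slotY B Ys cube (lam12 W ρ)),
                Tsum ((polysOf (lam12 W ρ)).image (cvsupp adj (lam12 W ρ))) (locv (cubeIn cube (lam12 W ρ) ∘ γ'))
                  (wv (prime (g3 adj fun H' => zG blk (interpForm blk Δ (corner ℝ (lam12' adj W ρ))) (0 : α → ℝ)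
                    (fD (uD χ p ek (slotB B Ys cube (lam12 W ρ)) (fun b : ↥B => Φ b) (fun b : ↥B => c b)
                      (slotY B Ys cube (lam12 W ρ)) (fun Y : ↥Ys => V Y) t) (cubeIn cube (lam12 W ρ)) γ' H')))) univ) nbar)) := by
  refine eq5145_zG_linear_remR_of_ineq5144 blk Δ 0 adj χ cube γ hR hD hnbr hθ0 hθ1 hβ hsmall hΔadj hΔ hχ hp hlin hc₀ hcb hV hK hek
    hek1 hΦloc hVloc F hFloc hL W Bl 𝒳 hX₀ Vconst PL W6pp s₀ (fun ρ _ b _ => ?_) h5144 h311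
  have h0 : src blk (0 : α → ℝ) (lam12 W ρ) = 0 := by funext x; rfl
  rw [h0, Matrix.mulVec_zero, ext_zero]
  exact ((hlin b b.2).mk' (Φ b)).map_zero

end Literature.MathematicalPhysics.QuantumFieldTheory.BalabanImbrieJaffe1984to88.BIJ88Eq5145Remainder

end
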